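/-
Copyright: the b2b-balaban cell (near-miss cell 7), T⁴-continuum CRUX team (coordinator ruling e34b3e0c item (2)),
seat t4-ne7b-formalise-leaf-06 (gen 29). Released under the licence of the surrounding project.
-/
import Summits.QuantumFields.BalabanUV.T4Continuum.Spine.NE7b.NonAbelianStokesReading
import Literature.MathematicalPhysics.QuantumFieldTheory.Balaban1983to89.B15ShellGauge193

/-!
# The near-flat filling of a box from near-flat shell data (route NE7b R-H, (S-k5.5) ∕ (1′) under (BOX))
# — print's p.193 shell gauge, `B15ShellGauge193.dist1_shellAct_le`, read on `ZdGaugeConfig`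

Cell `pub-balaban`, sub-cell `t4`, spine estimate NE7b (node U5c), candidate route R-H «Peierls healing map».
ROUTES-NE7b v7 (seat `t4-ne7b-idea-1` gen 7) §1 item 1 (1′) and §4 (S-k5.5) display the COMPETITOR binder of the
energy route (E): *«`hcomp : ∃ U₀` filling `H(x)` with boundary data `e`, action `U₀ ≤ c_fill²·diam(coll)⁴·a(e)²·ν` —
inhabited under (TC-box) by the axial-gauge near-flat filling of item 1 (1′)»*, i.e. by the construction of
[Bałaban, CMP 122 (1989)] p. 193: a generalized axial gauge on the SHELL of the parallelepiped makes every shell bond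
`O(M²ε)`-close to `1`; extend by `1` inside; undo the gauge. That construction is PROVED in the tree by the Literature
typers: `Balaban1983to89.B15ShellGauge193.dist1_shellAct_le` (on `ℤ^d`, `d ≥ 3`: in the shell path gauge `shellFn V lo hi`
every bond of the shell `[lo − 1, hi + 1] ∖ [lo, hi]` has `dist1 ≤ 3d(n+2)²ε`) and, on Bałaban's torus carrier,
`extension_shell_box` ∕ `extension193_shell_box`.

THIS FILE is the junction to the carrier of the PH-k ∕ (NAS) chain, `ZdGaugeConfig d G` (leaf-01's
`NonAbelianStokesReading.curry` dictionary), with the action arithmetic: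
* **`boxFill U lo hi`** — the filling: `g(y)⁻¹·g(y + e_μ)` on the bonds TOUCHING the box `[lo, hi]` (an endpoint in it),
  `g y = V(Γ_y)` the shell-path transport of p. 193 (`= B15ShellGauge193.shellFn (curry U) lo hi`), and `U` on every
  other bond (`boxFill_apply_of_not_touches`): the filling keeps the exterior data;
* **`dist1_plaquette_boxFill_le`** — under `ShellPlaqSmall (curry U) lo hi ε` (print's regularity hypothesis, see the
  CAVEAT), `3 ≤ d`, `lo ≤ hi ≤ lo + n`: EVERY plaquette with its four corners in the big box `[lo − 1, hi + 1]` has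
  `dist1 ≤ 12·d·(n+2)²·ε` (`plaquette_boxFill_eq`: the filled plaquette is the `g(x)⁻¹`-conjugate of a product of four
  shell-gauged bonds or `1`'s; `dist1_shellAct_le` ×4 BY NAME); plaquettes none of whose bonds touches the box are
  UNCHANGED (`plaquette_boxFill_eq_of_forall_not_touches`); so EVERY plaquette (`i ≠ j`) is untouched or near-flat
  (**`plaquette_boxFill_eq_or_dist1_le`**), and plaquettes meeting the box in all four bonds are EXACTLY `1`;
* **`sphere_norm_plaquette_boxFill_sub_one_le`**, **`sphere_action_plaquette_boxFill_le`**,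
  **`sphere_action_sum_boxFill_le`** — the `S³` (unit-quaternion, PH-k carrier) readings: `‖U₀(∂p) − 1‖ ≤ 12d(n+2)²ε`
  and, since `1 − re q = ½‖q − 1‖²` on `S³`, the Wilson action of the filling over any finset `T` of such plaquettes is
  `≤ #T · 72·d²·(n+2)⁴·ε²` — the displayed `hcomp` shape `c_fill²·diam⁴·a²·ν` with every constant explicit.

CAVEAT, LOCATED (for the route author ∕ refuter). The hypothesis is PRINT's: `ShellPlaqSmall V lo hi ε` asks
`ε`-smallness of every unit plaquette based at a point with a coordinate frozen at `lo − 1` or `hi + 1` outside its two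
directions — whole coordinate hyperplanes through the shell faces (torus form: `PlaqSmallOn (outPlaqs Λ)`, the entire
exterior, p. 193's *«V_k regular on Z ∩ Λᶜ»*); R-H's (1′) wants the COLLAR-LOCAL hypothesis. Under the (R-top) cut every
plaquette of the support is TAME (ROUTES v7 item 1(iv): `≤ ε_T`), so this inhabitant is usable with `ε := ε_T`. The sharp
`ε := a(e)` form is NOT done here; [v1.1 erratum, leaf-01 g29 `CLAIMS.log` l.30101 + XREAD C-ne7bleaf01g29-4 (d)] the
collar-local gauge bound it needs IS ALREADY IN THE TREE by another printed route — `Balaban1983to89.B16Ineq382`'s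
`norm_bond_sub_one_le` + `case1Hyp_gaugeFixed` ([Bałaban, Large field II] pp. 381–382 over the p. 196 tree gauge, on an
annulus of any thickness `≥ 1`, hypothesis only on plaquettes with all four corners in the annulus) on the normed-units
carrier `U1 𝔸`, transferable to `S³`∕`SU(2)` along `unitSphereToUnits` ∕ `toHomUnits`; on an abstract `[GaugeGroup G]` no.

HONEST FRAMING. Law-free lattice gauge algebra on ONE configuration, over a Literature reproduction the tree PROVES
(nothing of p. 193 is cited as a fact); nothing of bill A∕B's arithmetic, (MP<L²), (JC), (LD-G), H1–H3 asserted; (TC-box)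
itself (a `π₁` statement) is not formalised. NE7b (`T4WeightBudget.RelWeightBound`) NOT PRINTED, NOT PROVED; spine PROVED
0∕9; rung (B)+1 on a FINITE torus T⁴ — NOT infinite volume, NOT the mass gap, NOT Clay. HONEST DEPENDENCY: continuum YM on
T⁴ ⇐ BetaPertH ∧ nine spine estimates (0/9 proved); BetaPertH ⇐ (D1) ∧ (D4) ∧ CAP+tail; G-an2-4 gates asym, D1 and NE2/3/4.
POLICY: crux-route work under `Spine/NE7b/` (FREEZE (0) respected); four concrete definitions, no `Prop`-valued fact, no `[cite:]`.
-/

set_option autoImplicit false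

namespace Summit.QuantumFields.BalabanUV.T4Continuum.NE7b.BoxNearFlatFilling

noncomputable section

open scoped Quaternion
open Literature.MathematicalPhysics.QuantumFieldTheory.Balaban1983to89 (GaugeGroup dist1)
open Literature.MathematicalPhysics.QuantumFieldTheory.Balaban1983to89.B7Prop1Explicit (e e_apply hol gaugeAct plaqWord)
open Literature.MathematicalPhysics.QuantumFieldTheory.Balaban1983to89.B8Lemma1NonAbelian (e_nonneg)
open Literature.MathematicalPhysics.QuantumFieldTheory.Balaban1983to89.B15ShellGauge193
  (Frozen ShellPlaqSmall pathWord shellFn dist1_shellAct_le)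
open Literature.MathematicalPhysics.QuantumFieldTheory (ZdEdge ZdGaugeConfig)
open Summit.QuantumFields.BalabanUV.T4Continuum.NE7b.NonAbelianStokesReading (curry plaquette_eq_hol_plaqWord sphereGaugeGroup)

variable {d : ℕ} {G : Type*}

/-! ## §1 The box, its big box, and the bonds touching it -/

/-- The set of bonds `⟨y, y + e_μ⟩` TOUCHING the box `[lo, hi]`: one endpoint lies in the box. These are exactly the bonds
the filling overwrites. -/
def touchingBonds (lo hi : Fin d → ℤ) : Set (ZdEdge d) :=
  {b | (lo ≤ b.1 ∧ b.1 ≤ hi) ∨ (lo ≤ b.1 + e b.2 ∧ b.1 + e b.2 ≤ hi)}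

/-- Membership in `touchingBonds`, spelled out. -/
theorem mem_touchingBonds_iff (lo hi y : Fin d → ℤ) (μ : Fin d) :
    (y, μ) ∈ touchingBonds lo hi ↔ (lo ≤ y ∧ y ≤ hi) ∨ (lo ≤ y + e μ ∧ y + e μ ≤ hi) := Iff.rfl

/-- `e_μ ≤ 1` in the product order. -/
theorem e_le_one (μ : Fin d) : (e μ : Fin d → ℤ) ≤ 1 := by
  intro κ; simp only [e_apply, Pi.one_apply]; split_ifs <;> norm_num

/-- For `i ≠ j`, `e_i + e_j ≤ 1` in the product order. -/
theorem e_add_e_le_one {i j : Fin d} (hij : i ≠ j) : (e i + e j : Fin d → ℤ) ≤ 1 := by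
  intro κ
  simp only [Pi.add_apply, e_apply, Pi.one_apply]
  split_ifs with h1 h2 <;> first | exact absurd (h1.symm.trans h2) hij | norm_num

/-- If a point `z` between the corners `x` and `x + e_i + e_j` (`i ≠ j`) of a plaquette lies in the box, then all four
corners lie in the big box `[lo − 1, hi + 1]`. -/
theorem bigBox_of_mem_box_between {lo hi x z : Fin d → ℤ} {i j : Fin d} (hij : i ≠ j) (hxz : x ≤ z)
    (hzx : z ≤ x + e i + e j) (hz : lo ≤ z ∧ z ≤ hi) : lo - 1 ≤ x ∧ x + e i + e j ≤ hi + 1 := by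
  have h1 := e_add_e_le_one (d := d) hij
  constructor
  · intro κ; have a := hz.1 κ; have b := hzx κ; have c := h1 κ
    simp only [Pi.add_apply, Pi.sub_apply, Pi.one_apply] at a b c ⊢; linarith
  · intro κ; have a := hz.2 κ; have b := hxz κ; have c := h1 κ
    simp only [Pi.add_apply, Pi.one_apply] at a b c ⊢; linarith

/-- A touching bond lies in the big box `[lo − 1, hi + 1]`. -/
theorem bigBox_of_touches {lo hi y : Fin d → ℤ} {μ : Fin d} (h : (y, μ) ∈ touchingBonds lo hi) :
    lo - 1 ≤ y ∧ y + e μ ≤ hi + 1 := by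
  rw [mem_touchingBonds_iff] at h
  rcases h with ⟨h1, h2⟩ | ⟨h1, h2⟩
  · exact ⟨fun κ => by have := h1 κ; simp only [Pi.sub_apply, Pi.one_apply]; linarith,
      add_le_add h2 (e_le_one μ)⟩
  · refine ⟨fun κ => ?_, h2.trans (le_add_of_nonneg_right zero_le_one)⟩
    have h1κ := h1 κ
    have heκ := e_le_one (d := d) μ κ
    simp only [Pi.add_apply, Pi.one_apply, Pi.sub_apply] at h1κ heκ ⊢
    linarith

/-- A point of the big box outside the box has a FROZEN coordinate (`= lo − 1` or `= hi + 1`): it lies in the shell. -/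
theorem exists_frozen_of_not_inBox {lo hi z : Fin d → ℤ} (hlo : lo - 1 ≤ z) (hhi : z ≤ hi + 1)
    (h : ¬ (lo ≤ z ∧ z ≤ hi)) : ∃ κ₀, Frozen lo hi κ₀ z := by
  by_contra hcon
  apply h
  refine ⟨fun κ => ?_, fun κ => ?_⟩
  · have h1 : lo κ - 1 ≤ z κ := by simpa using hlo κ
    have h2 : ¬ (z κ = lo κ - 1 ∨ z κ = hi κ + 1) := fun hf => hcon ⟨κ, hf⟩
    by_contra hlt
    have hlt' : z κ + 1 ≤ lo κ := Int.lt_iff_add_one_le.mp (not_le.mp hlt)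
    exact h2 (Or.inl (le_antisymm (by linarith) h1))
  · have h1 : z κ ≤ hi κ + 1 := by simpa using hhi κ
    have h2 : ¬ (z κ = lo κ - 1 ∨ z κ = hi κ + 1) := fun hf => hcon ⟨κ, hf⟩
    by_contra hlt
    have hlt' : hi κ + 1 ≤ z κ := Int.lt_iff_add_one_le.mp (not_le.mp hlt)
    exact h2 (Or.inr (le_antisymm h1 hlt'))

/-! ## §2 The filling (any group) -/

section AnyGroup

variable [Group G]

/-- The shell-path transport `g(y) = V(Γ_y)` of p. 193 from the corner `lo − 1` (`= B15ShellGauge193.shellFn (curry U) lo hi y`,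
`shellGaugeFn_eq_shellFn`; restated over `[Group G]` only). -/
def shellGaugeFn (U : ZdGaugeConfig d G) (lo hi : Fin d → ℤ) (y : Fin d → ℤ) : G :=
  hol (curry U) (lo - 1) (pathWord lo hi y)

open scoped Classical in
/-- The SHELL-GAUGED EXTENSION in the gauge-fixed picture: `1` on the bonds touching the box, the shell-gauged bond
variable `g(y)·U(y, μ)·g(y + e_μ)⁻¹` elsewhere (p. 193: *«we extend it putting V′_k(b′) = 1 for b′ ∈ Λ»*). -/
def shellExt (U : ZdGaugeConfig d G) (lo hi : Fin d → ℤ) (y : Fin d → ℤ) (μ : Fin d) : G :=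
  if (y, μ) ∈ touchingBonds lo hi then 1 else gaugeAct (shellGaugeFn U lo hi) (curry U) y μ

open scoped Classical in
/-- **THE FILLING** `boxFill U lo hi : ZdGaugeConfig d G` (p. 193's extension with the shell gauge undone): the pure
gauge `g(y)⁻¹·g(y + e_μ)` on the bonds touching the box `[lo, hi]`, the given `U` on every other bond. -/
def boxFill (U : ZdGaugeConfig d G) (lo hi : Fin d → ℤ) : ZdGaugeConfig d G := fun b =>
  if b ∈ touchingBonds lo hi then (shellGaugeFn U lo hi b.1)⁻¹ * shellGaugeFn U lo hi (b.1 + e b.2) else U b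

/-- **THE FILLING KEEPS THE EXTERIOR DATA**: on a bond not touching the box, `boxFill U = U`. -/
theorem boxFill_apply_of_not_touches (U : ZdGaugeConfig d G) (lo hi : Fin d → ℤ) {y : Fin d → ℤ} {μ : Fin d}
    (h : (y, μ) ∉ touchingBonds lo hi) : boxFill U lo hi (y, μ) = U (y, μ) := by
  classical
  simp only [boxFill, if_neg h]

/-- On a touching bond the filling is the pure gauge `g(y)⁻¹·g(y + e_μ)`. -/
theorem boxFill_apply_of_touches (U : ZdGaugeConfig d G) (lo hi : Fin d → ℤ) {y : Fin d → ℤ} {μ : Fin d}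
    (h : (y, μ) ∈ touchingBonds lo hi) :
    boxFill U lo hi (y, μ) = (shellGaugeFn U lo hi y)⁻¹ * shellGaugeFn U lo hi (y + e μ) := by
  classical
  simp only [boxFill, if_pos h]

/-- The filling is the `g⁻¹`-gauge transform of the shell-gauged extension:
`boxFill U (y, μ) = g(y)⁻¹ · shellExt U y μ · g(y + e_μ)`. -/
theorem boxFill_apply_eq (U : ZdGaugeConfig d G) (lo hi : Fin d → ℤ) (y : Fin d → ℤ) (μ : Fin d) :
    boxFill U lo hi (y, μ) = (shellGaugeFn U lo hi y)⁻¹ * shellExt U lo hi y μ * shellGaugeFn U lo hi (y + e μ) := by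
  classical
  by_cases h : (y, μ) ∈ touchingBonds lo hi
  · rw [boxFill_apply_of_touches U lo hi h, shellExt, if_pos h, mul_one]
  · rw [boxFill_apply_of_not_touches U lo hi h, shellExt, if_neg h, gaugeAct]
    simp only [curry]
    group

/-- **A FILLED PLAQUETTE IS A CONJUGATED PRODUCT OF FOUR SHELL-GAUGED BONDS (or `1`'s)**:
`boxFill U (∂p_{ij}(x)) = g(x)⁻¹ · [E(x,i) E(x+eᵢ,j) E(x+eⱼ,i)⁻¹ E(x,j)⁻¹] · g(x)`, `E = shellExt U lo hi`. -/
theorem plaquette_boxFill_eq (U : ZdGaugeConfig d G) (lo hi : Fin d → ℤ) (x : Fin d → ℤ) (i j : Fin d) :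
    ZdGaugeConfig.plaquette (boxFill U lo hi) x i j =
      (shellGaugeFn U lo hi x)⁻¹ *
        (shellExt U lo hi x i * shellExt U lo hi (x + e i) j * (shellExt U lo hi (x + e j) i)⁻¹ *
          (shellExt U lo hi x j)⁻¹) * shellGaugeFn U lo hi x := by
  have h1 : (x + Pi.single i 1 : Fin d → ℤ) = x + e i := rfl
  have h2 : (x + Pi.single j 1 : Fin d → ℤ) = x + e j := rfl
  rw [ZdGaugeConfig.plaquette, h1, h2, boxFill_apply_eq, boxFill_apply_eq, boxFill_apply_eq, boxFill_apply_eq,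
    add_right_comm x (e j) (e i)]
  group

/-- A plaquette NONE of whose four bonds touches the box is unchanged by the filling. -/
theorem plaquette_boxFill_eq_of_forall_not_touches (U : ZdGaugeConfig d G) (lo hi : Fin d → ℤ) (x : Fin d → ℤ)
    (i j : Fin d) (h1 : (x, i) ∉ touchingBonds lo hi) (h2 : (x + e i, j) ∉ touchingBonds lo hi)
    (h3 : (x + e j, i) ∉ touchingBonds lo hi) (h4 : (x, j) ∉ touchingBonds lo hi) :
    ZdGaugeConfig.plaquette (boxFill U lo hi) x i j = ZdGaugeConfig.plaquette U x i j := by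
  have e1 : (x + Pi.single i 1 : Fin d → ℤ) = x + e i := rfl
  have e2 : (x + Pi.single j 1 : Fin d → ℤ) = x + e j := rfl
  rw [ZdGaugeConfig.plaquette, ZdGaugeConfig.plaquette, e1, e2, boxFill_apply_of_not_touches U lo hi h1,
    boxFill_apply_of_not_touches U lo hi h2, boxFill_apply_of_not_touches U lo hi h3,
    boxFill_apply_of_not_touches U lo hi h4]

/-- On a touching bond the shell-gauged extension is `1`. -/
theorem shellExt_of_touches (U : ZdGaugeConfig d G) (lo hi : Fin d → ℤ) {y : Fin d → ℤ} {μ : Fin d}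
    (h : (y, μ) ∈ touchingBonds lo hi) : shellExt U lo hi y μ = 1 := by
  classical
  simp only [shellExt, if_pos h]

/-- **FLAT INSIDE**: a plaquette ALL of whose four bonds touch the box (e.g. any plaquette with a corner in the box) is
EXACTLY `1` after filling (p. 193: *«V′_k(b′) = 1 for b′ ∈ Λ»*, gauged back). -/
theorem plaquette_boxFill_eq_one_of_forall_touches (U : ZdGaugeConfig d G) (lo hi : Fin d → ℤ) (x : Fin d → ℤ)
    (i j : Fin d) (h1 : (x, i) ∈ touchingBonds lo hi) (h2 : (x + e i, j) ∈ touchingBonds lo hi)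
    (h3 : (x + e j, i) ∈ touchingBonds lo hi) (h4 : (x, j) ∈ touchingBonds lo hi) :
    ZdGaugeConfig.plaquette (boxFill U lo hi) x i j = 1 := by
  rw [plaquette_boxFill_eq, shellExt_of_touches U lo hi h1, shellExt_of_touches U lo hi h2, shellExt_of_touches U lo hi h3,
    shellExt_of_touches U lo hi h4]
  group

end AnyGroup

/-! ## §3 Sizes (any `GaugeGroup`): the `12·d·(n+2)²·ε` bound -/

section Sizes

variable [GaugeGroup G]

/-- `shellGaugeFn` IS the tree's shell gauge function. -/
theorem shellGaugeFn_eq_shellFn (U : ZdGaugeConfig d G) (lo hi : Fin d → ℤ) :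
    shellGaugeFn U lo hi = shellFn (curry U) lo hi := rfl

/-- `ShellPlaqSmall` read on `ZdGaugeConfig.plaquette` (leaf-01's `plaquette_eq_hol_plaqWord`). -/
theorem shellPlaqSmall_of_plaquette (U : ZdGaugeConfig d G) (lo hi : Fin d → ℤ) {ε : ℝ}
    (h : ∀ (z : Fin d → ℤ) (κ ν κ₀ : Fin d), κ ≠ ν → κ₀ ≠ κ → κ₀ ≠ ν → Frozen lo hi κ₀ z →
      dist1 (ZdGaugeConfig.plaquette U z κ ν) ≤ ε) :
    ShellPlaqSmall (curry U) lo hi ε := fun z κ ν κ₀ hκν h0κ h0ν hz => by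
  rw [← plaquette_eq_hol_plaqWord]; exact h z κ ν κ₀ hκν h0κ h0ν hz

/-- NON-VACUITY of the hypothesis: the flat configuration satisfies `ShellPlaqSmall` with `ε = 0`. -/
example (lo hi : Fin d → ℤ) : ShellPlaqSmall (curry (fun _ : ZdEdge d => (1 : G))) lo hi 0 :=
  shellPlaqSmall_of_plaquette _ lo hi fun z κ ν κ₀ _ _ _ _ => by
    simp [ZdGaugeConfig.plaquette, GaugeGroup.dist1_one]

/-- `dist1 (a⁻¹ · b · a) = dist1 b` (bi-invariance). -/
theorem dist1_inv_mul_mul (a b : G) : dist1 (a⁻¹ * b * a) = dist1 b := by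
  simpa using GaugeGroup.dist1_conj b a⁻¹

/-- `dist1` of a plaquette-shaped product of four factors. -/
theorem dist1_four_le (a b c f : G) {s : ℝ} (ha : dist1 a ≤ s) (hb : dist1 b ≤ s) (hc : dist1 c ≤ s)
    (hf : dist1 f ≤ s) : dist1 (a * b * c⁻¹ * f⁻¹) ≤ 4 * s := by
  have h1 := GaugeGroup.dist1_mul_le (a * b * c⁻¹) f⁻¹
  have h2 := GaugeGroup.dist1_mul_le (a * b) c⁻¹
  have h3 := GaugeGroup.dist1_mul_le a b
  rw [GaugeGroup.dist1_inv] at h1 h2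
  linarith

/-- **THE BOND BOUND** (p. 193's *«|V′_k(b′) − 1| < O(1)M²ε»*, `B15ShellGauge193.dist1_shellAct_le` BY NAME, and `1` on
the touching bonds): every bond of the big box has `dist1 (shellExt U y μ) ≤ 3·d·(n+2)²·ε`. -/
theorem dist1_shellExt_le (U : ZdGaugeConfig d G) {lo hi : Fin d → ℤ} {ε : ℝ} (hV : ShellPlaqSmall (curry U) lo hi ε)
    (hε : 0 ≤ ε) (hd : 3 ≤ d) (hlohi : lo ≤ hi) {n : ℕ} (hn : ∀ κ, hi κ ≤ lo κ + n) {y : Fin d → ℤ} {μ : Fin d}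
    (hy : lo - 1 ≤ y) (hyμ : y + e μ ≤ hi + 1) :
    dist1 (shellExt U lo hi y μ) ≤ 3 * d * (n + 2) ^ 2 * ε := by
  classical
  by_cases h : (y, μ) ∈ touchingBonds lo hi
  · rw [shellExt, if_pos h, GaugeGroup.dist1_one]; positivity
  · rw [shellExt, if_neg h, shellGaugeFn_eq_shellFn]
    simp only [mem_touchingBonds_iff, not_or] at h
    have hy' : y ≤ hi + 1 := (le_add_of_nonneg_right (e_nonneg μ)).trans hyμ
    have hyμ' : lo - 1 ≤ y + e μ := hy.trans (le_add_of_nonneg_right (e_nonneg μ))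
    exact dist1_shellAct_le hV hε hd hlohi hn hy hyμ (exists_frozen_of_not_inBox hy hy' h.1)
      (exists_frozen_of_not_inBox hyμ' hyμ h.2)

/-- **EVERY PLAQUETTE OF THE BIG BOX IS NEAR-FLAT AFTER FILLING**: if the four corners of `p_{ij}(x)` lie in
`[lo − 1, hi + 1]` then `dist1 (boxFill U (∂p)) ≤ 12·d·(n+2)²·ε` (`= 4 × 3d(n+2)²ε`; the torus twin is
`B15ShellGauge193.extension_shell_box`'s `4 * (3 * d * (n + 2) ^ 2 * ε)`). -/
theorem dist1_plaquette_boxFill_le (U : ZdGaugeConfig d G) {lo hi : Fin d → ℤ} {ε : ℝ}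
    (hV : ShellPlaqSmall (curry U) lo hi ε) (hε : 0 ≤ ε) (hd : 3 ≤ d) (hlohi : lo ≤ hi) {n : ℕ}
    (hn : ∀ κ, hi κ ≤ lo κ + n) {x : Fin d → ℤ} {i j : Fin d} (hx : lo - 1 ≤ x) (hxij : x + e i + e j ≤ hi + 1) :
    dist1 (ZdGaugeConfig.plaquette (boxFill U lo hi) x i j) ≤ 12 * d * (n + 2) ^ 2 * ε := by
  have hi1 : x + e i ≤ hi + 1 := (le_add_of_nonneg_right (e_nonneg j)).trans hxij
  have hj1 : x + e j ≤ hi + 1 := (le_add_of_nonneg_right (e_nonneg i)).trans (by rwa [add_right_comm] at hxij)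
  have hxi : lo - 1 ≤ x + e i := hx.trans (le_add_of_nonneg_right (e_nonneg i))
  have hxj : lo - 1 ≤ x + e j := hx.trans (le_add_of_nonneg_right (e_nonneg j))
  have hxji : x + e j + e i ≤ hi + 1 := by rwa [add_right_comm]
  rw [plaquette_boxFill_eq, dist1_inv_mul_mul]
  have h := dist1_four_le _ _ _ _ (dist1_shellExt_le U hV hε hd hlohi hn hx hi1)
    (dist1_shellExt_le U hV hε hd hlohi hn hxi hxij) (dist1_shellExt_le U hV hε hd hlohi hn hxj hxji)
    (dist1_shellExt_le U hV hε hd hlohi hn hx hj1)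
  linarith

/-- **EVERY PLAQUETTE IS EITHER UNTOUCHED OR NEAR-FLAT** (`i ≠ j`): if none of its four bonds touches the box the
filling leaves it as it was; otherwise its four corners lie in the big box and `dist1 ≤ 12·d·(n+2)²·ε`. -/
theorem plaquette_boxFill_eq_or_dist1_le (U : ZdGaugeConfig d G) {lo hi : Fin d → ℤ} {ε : ℝ}
    (hV : ShellPlaqSmall (curry U) lo hi ε) (hε : 0 ≤ ε) (hd : 3 ≤ d) (hlohi : lo ≤ hi) {n : ℕ}
    (hn : ∀ κ, hi κ ≤ lo κ + n) (x : Fin d → ℤ) {i j : Fin d} (hij : i ≠ j) :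
    ZdGaugeConfig.plaquette (boxFill U lo hi) x i j = ZdGaugeConfig.plaquette U x i j ∨
      dist1 (ZdGaugeConfig.plaquette (boxFill U lo hi) x i j) ≤ 12 * d * (n + 2) ^ 2 * ε := by
  classical
  have hi0 := e_nonneg (d := d) i
  have hj0 := e_nonneg (d := d) j
  have hx1 : x ≤ x + e i := le_add_of_nonneg_right hi0
  have hx2 : x ≤ x + e j := le_add_of_nonneg_right hj0
  have hy1 : x + e i ≤ x + e i + e j := le_add_of_nonneg_right hj0
  have hx3 : x ≤ x + e i + e j := hx1.trans hy1
  have hy2 : x + e j ≤ x + e i + e j := by rw [add_right_comm]; exact le_add_of_nonneg_right hi0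
  have hy3 : x + e j + e i = x + e i + e j := add_right_comm _ _ _
  by_cases h : (x, i) ∈ touchingBonds lo hi ∨ (x + e i, j) ∈ touchingBonds lo hi ∨
      (x + e j, i) ∈ touchingBonds lo hi ∨ (x, j) ∈ touchingBonds lo hi
  · right
    have hr : lo - 1 ≤ x ∧ x + e i + e j ≤ hi + 1 := by
      simp only [mem_touchingBonds_iff] at h
      rcases h with (h | h) | (h | h) | (h | h) | (h | h)
      · exact bigBox_of_mem_box_between hij le_rfl hx3 h
      · exact bigBox_of_mem_box_between hij hx1 hy1 h
      · exact bigBox_of_mem_box_between hij hx1 hy1 h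
      · exact bigBox_of_mem_box_between hij hx3 le_rfl h
      · exact bigBox_of_mem_box_between hij hx2 hy2 h
      · exact bigBox_of_mem_box_between hij (hy3 ▸ hx3) (hy3 ▸ le_rfl) h
      · exact bigBox_of_mem_box_between hij le_rfl hx3 h
      · exact bigBox_of_mem_box_between hij hx2 hy2 h
    exact dist1_plaquette_boxFill_le U hV hε hd hlohi hn hr.1 hr.2
  · left
    simp only [not_or] at h
    exact plaquette_boxFill_eq_of_forall_not_touches U lo hi x i j h.1 h.2.1 h.2.2.1 h.2.2.2

end Sizes

/-! ## §4 The `S³` readings: plain norms and the Wilson action of the filling (the `hcomp` shape) -/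

section Sphere

/-- On the unit sphere of `ℍ`: `1 − re q = ½‖q − 1‖²`. -/
theorem one_sub_re_eq_half_norm_sub_one_sq (q : Metric.sphere (0 : ℍ) 1) :
    1 - (q : ℍ).re = (1 / 2 : ℝ) * ‖(q : ℍ) - 1‖ ^ 2 := by
  have hq : ‖(q : ℍ)‖ = 1 := mem_sphere_zero_iff_norm.mp q.2
  have h1 : ‖(q : ℍ)‖ ^ 2 = (q : ℍ).re ^ 2 + (q : ℍ).imI ^ 2 + (q : ℍ).imJ ^ 2 + (q : ℍ).imK ^ 2 := by
    rw [sq, ← Quaternion.normSq_eq_norm_mul_self, Quaternion.normSq_def']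
  have h2 : ‖(q : ℍ) - 1‖ ^ 2 =
      ((q : ℍ).re - 1) ^ 2 + (q : ℍ).imI ^ 2 + (q : ℍ).imJ ^ 2 + (q : ℍ).imK ^ 2 := by
    rw [sq, ← Quaternion.normSq_eq_norm_mul_self, Quaternion.normSq_def']
    simp only [Quaternion.re_sub, Quaternion.imI_sub, Quaternion.imJ_sub, Quaternion.imK_sub, Quaternion.re_one,
      Quaternion.imI_one, Quaternion.imJ_one, Quaternion.imK_one, sub_zero]
  rw [hq] at h1
  nlinarith [h1, h2]

variable (U : ZdGaugeConfig d (Metric.sphere (0 : ℍ) 1)) {lo hi : Fin d → ℤ} {ε : ℝ}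

/-- **NEAR-FLAT FILLING ON THE PH-k CARRIER** (`S³`-valued configurations, plain norms): if every plaquette based at a
point with a frozen coordinate outside its directions has `‖U(∂p) − 1‖ ≤ ε` (print's hypothesis, see the CAVEAT in the
header), then every plaquette of the big box satisfies `‖boxFill U (∂p) − 1‖ ≤ 12·d·(n+2)²·ε`. -/
theorem sphere_norm_plaquette_boxFill_sub_one_le
    (hV : ∀ (z : Fin d → ℤ) (κ ν κ₀ : Fin d), κ ≠ ν → κ₀ ≠ κ → κ₀ ≠ ν → Frozen lo hi κ₀ z →
      ‖((ZdGaugeConfig.plaquette U z κ ν : Metric.sphere (0 : ℍ) 1) : ℍ) - 1‖ ≤ ε)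
    (hε : 0 ≤ ε) (hd : 3 ≤ d) (hlohi : lo ≤ hi) {n : ℕ} (hn : ∀ κ, hi κ ≤ lo κ + n) {x : Fin d → ℤ} {i j : Fin d}
    (hx : lo - 1 ≤ x) (hxij : x + e i + e j ≤ hi + 1) :
    ‖((ZdGaugeConfig.plaquette (boxFill U lo hi) x i j : Metric.sphere (0 : ℍ) 1) : ℍ) - 1‖ ≤
      12 * d * (n + 2) ^ 2 * ε := by
  letI : GaugeGroup (Metric.sphere (0 : ℍ) 1) := sphereGaugeGroup
  exact dist1_plaquette_boxFill_le U (shellPlaqSmall_of_plaquette U lo hi hV) hε hd hlohi hn hx hxij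

/-- **THE WILSON ACTION OF ONE FILLED PLAQUETTE**: `1 − re(boxFill U (∂p)) ≤ ½·(12·d·(n+2)²·ε)² = 72·d²·(n+2)⁴·ε²`. -/
theorem sphere_action_plaquette_boxFill_le
    (hV : ∀ (z : Fin d → ℤ) (κ ν κ₀ : Fin d), κ ≠ ν → κ₀ ≠ κ → κ₀ ≠ ν → Frozen lo hi κ₀ z →
      ‖((ZdGaugeConfig.plaquette U z κ ν : Metric.sphere (0 : ℍ) 1) : ℍ) - 1‖ ≤ ε)
    (hε : 0 ≤ ε) (hd : 3 ≤ d) (hlohi : lo ≤ hi) {n : ℕ} (hn : ∀ κ, hi κ ≤ lo κ + n) {x : Fin d → ℤ} {i j : Fin d}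
    (hx : lo - 1 ≤ x) (hxij : x + e i + e j ≤ hi + 1) :
    1 - ((ZdGaugeConfig.plaquette (boxFill U lo hi) x i j : Metric.sphere (0 : ℍ) 1) : ℍ).re ≤
      72 * (d : ℝ) ^ 2 * (n + 2) ^ 4 * ε ^ 2 := by
  have h := sphere_norm_plaquette_boxFill_sub_one_le U hV hε hd hlohi hn hx hxij
  have h0 : 0 ≤ ‖((ZdGaugeConfig.plaquette (boxFill U lo hi) x i j : Metric.sphere (0 : ℍ) 1) : ℍ) - 1‖ :=
    norm_nonneg _
  rw [one_sub_re_eq_half_norm_sub_one_sq]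
  have h2 : ‖((ZdGaugeConfig.plaquette (boxFill U lo hi) x i j : Metric.sphere (0 : ℍ) 1) : ℍ) - 1‖ ^ 2 ≤
      (12 * d * (n + 2) ^ 2 * ε) ^ 2 := pow_le_pow_left₀ h0 h 2
  nlinarith [h2]

/-- **THE `hcomp` SHAPE** (ROUTES-NE7b v7 (S-k5.5): *«action `U₀ ≤ c_fill²·diam(coll)⁴·a(e)²·ν`»*): over any finite
set `T` of plaquettes of the big box, the Wilson action of the filling is at most `#T · 72·d²·(n+2)⁴·ε²`. -/
theorem sphere_action_sum_boxFill_le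
    (hV : ∀ (z : Fin d → ℤ) (κ ν κ₀ : Fin d), κ ≠ ν → κ₀ ≠ κ → κ₀ ≠ ν → Frozen lo hi κ₀ z →
      ‖((ZdGaugeConfig.plaquette U z κ ν : Metric.sphere (0 : ℍ) 1) : ℍ) - 1‖ ≤ ε)
    (hε : 0 ≤ ε) (hd : 3 ≤ d) (hlohi : lo ≤ hi) {n : ℕ} (hn : ∀ κ, hi κ ≤ lo κ + n)
    (T : Finset ((Fin d → ℤ) × Fin d × Fin d))
    (hT : ∀ t ∈ T, lo - 1 ≤ t.1 ∧ t.1 + e t.2.1 + e t.2.2 ≤ hi + 1) :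
    ∑ t ∈ T, (1 - ((ZdGaugeConfig.plaquette (boxFill U lo hi) t.1 t.2.1 t.2.2 : Metric.sphere (0 : ℍ) 1) : ℍ).re) ≤
      T.card * (72 * (d : ℝ) ^ 2 * (n + 2) ^ 4 * ε ^ 2) := by
  calc ∑ t ∈ T, (1 - ((ZdGaugeConfig.plaquette (boxFill U lo hi) t.1 t.2.1 t.2.2 : Metric.sphere (0 : ℍ) 1) : ℍ).re)
      ≤ ∑ t ∈ T, 72 * (d : ℝ) ^ 2 * (n + 2) ^ 4 * ε ^ 2 :=
        Finset.sum_le_sum fun t ht => sphere_action_plaquette_boxFill_le U hV hε hd hlohi hn (hT t ht).1 (hT t ht).2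
    _ = T.card * (72 * (d : ℝ) ^ 2 * (n + 2) ^ 4 * ε ^ 2) := by rw [Finset.sum_const, nsmul_eq_mul]

end Sphere

end

end Summit.QuantumFields.BalabanUV.T4Continuum.NE7b.BoxNearFlatFilling
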